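import Literature.AlgebraicGeometry.Resolution.MacaulayficationPStandardDSequence
import Mathlib.Algebra.BigOperators.Intervals
import HarnessLib

/-!
# Kawasaki's interwoven induction: the statements (A)–(E) (Kawasaki 2000, Thm. 3.1)

Topic: `Literature/AlgebraicGeometry/Resolution`. Brick of the proof of the named facts
`KawasakiMacaulayfication` / `CesnaviciusMacaulayfication`; sequel of
`MacaulayficationPStandardDSequence.lean`. Kawasaki 2000, Theorem 3.1 establishes, for a
`p`-standard system of parameters `x₁,…,x_d` of `M` (type `d-1` here), `qᵢ = (xᵢ,…,x_d)` and all
`1 ≤ i ≤ j ≤ d`, positive integers `nᵢ,…,nⱼ`, five families of colon identities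
`(A_ij), (B_ij), (C_ij), (D_ij), (E_ij)` by an interwoven induction on `j - i` (Steps 1–9,
pp. 2523–2530); its corollaries 3.2 and 3.3 are properties (KI-c) and (KI-a) of Česnavičius 2021,
Thm. 3.10, the input of the Cohen–Macaulayness of Kawasaki's blowing up. This file fixes the
VOCABULARY of that induction and records the five statements as `Prop`-valued definitions, so
that the steps (sequel files `MacaulayficationKawasakiStep*.lean`) are implications between named
statements:

* `tailIdeal xs i = qᵢ₊₁ = (xs[i], …, xs[d-1])` (`0`-based), `seg xs k l = [xs[k], …, xs[l-1]]`,
  `prodPow xs n i j = ∏_{t=i}^{j} (tailIdeal xs t)^(n t)` and their bookkeeping;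
* `Kawasaki.A31 … Kawasaki.E31` — the statements (3.1.1)–(3.1.5) as printed, `0`-based
  (Lean `i` = Kawasaki's `i - 1`; "`y₁,…,y_u` is a subsystem of parameters for `M/qᵢM`" is
  `IsSecantSequence M (xs.drop i ++ ys)`; `x_Λ`, `Λ ⊆ {k,…,i-1}`, is a sublist of `seg xs k i`;
  Kawasaki's convention `x_{d+1} = 1` is `xs.getD l 1`);
* `IsKDSequence.sup_inf_sup_pow_smul_top` — the Goto–Yamagishi equality on `M/N` read in `M`
  (non-colon form), complementing `IsKDSequence.colonBy_inf_sup_pow_smul_top`.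

Everything is proved / a definition with a body; no named fact is introduced.

## References

* [Kawasaki2000] T. Kawasaki, *On Macaulayfication of Noetherian schemes*, Trans. AMS 352 (2000)
  2517–2552, Thm. 3.1 (statements (3.1.1)–(3.1.5), p. 2522–2523).
* [Cesnavicius2021] K. Česnavičius, Duke Math. J. 170 (2021) = arXiv:1810.04493v2, Thm. 3.10 and
  the paragraph after it ("[Kaw00] 3.1, which presents five statements `(A_ij),…,(E_ij)` … and
  then proves them by a somewhat lengthy interwoven induction on the difference `j - i`").
-/

namespace Literature.AlgebraicGeometry.Resolution

open Ideal Submodule Module IsLocalRing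
open scoped Pointwise

universe u v

/-! ## Segments of a list -/

section Lists

variable {α : Type*} {xs : List α}

/-- **The segment `x_{k+1},…,x_l`** (`0`-based: `[xs[k], …, xs[l-1]]`). [cite: Kawasaki2000, Thm. 3.1] -/
abbrev seg (xs : List α) (k l : ℕ) : List α := (xs.drop k).take (l - k)

/-- `seg xs k k = []`. [folklore] -/
@[simp]
theorem seg_self (xs : List α) (k : ℕ) : seg xs k k = [] := by
  simp [seg]

/-- `seg xs k (l+1) = seg xs k l ++ [xs[l]]` for `k ≤ l < d`. [folklore] -/
theorem seg_succ {k l : ℕ} (hkl : k ≤ l) (hl : l < xs.length) :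
    seg xs k (l + 1) = seg xs k l ++ [xs[l]] := by
  have h : l - k < (xs.drop k).length := by rw [List.length_drop]; omega
  have e : l + 1 - k = (l - k) + 1 := by omega
  simp only [seg, e, List.take_succ_eq_append_getElem h, List.getElem_drop, Nat.add_sub_cancel' hkl]

/-- `seg xs k l` is a sublist of `xs.drop k`. [folklore] -/
theorem seg_sublist_drop (xs : List α) (k l : ℕ) : (seg xs k l).Sublist (xs.drop k) :=
  List.take_sublist _ _

/-- `seg xs k l ++ xs.drop l = xs.drop k` for `k ≤ l`. [folklore] -/
theorem seg_append_drop {k l : ℕ} (hkl : k ≤ l) : seg xs k l ++ xs.drop l = xs.drop k := by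
  conv_rhs => rw [← List.take_append_drop (l - k) (xs.drop k)]
  rw [seg, List.drop_drop, Nat.add_sub_cancel' hkl]

/-- `seg xs k d = xs.drop k`. [folklore] -/
theorem seg_length (xs : List α) (k : ℕ) : seg xs k xs.length = xs.drop k :=
  List.take_of_length_le (by rw [List.length_drop])

end Lists

section Ring

variable {R : Type u} [CommRing R]

/-! ## `qᵢ` and the products `qᵢ^{nᵢ} ⋯ qⱼ^{nⱼ}` -/

/-- **`q_{i+1} = (x_{i+1},…,x_d)`** (`0`-based: the ideal generated by `xs.drop i`; `⊥` for
`i ≥ d`). [cite: Kawasaki2000, Thm. 3.1] -/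
abbrev tailIdeal (xs : List R) (i : ℕ) : Ideal R := ofList (xs.drop i)

/-- **The product `q_{i+1}^{n(i)} ⋯ q_{j+1}^{n(j)}`** over the interval `[i, j]` (`= R` if
`j < i`). [cite: Kawasaki2000, Thm. 3.1] -/
def prodPow (xs : List R) (n : ℕ → ℕ) (i j : ℕ) : Ideal R :=
  ∏ t ∈ Finset.Icc i j, tailIdeal xs t ^ n t

variable {xs : List R}

/-- `q_{i+2} ⊆ q_{i+1}`, iterated: `tailIdeal` is antitone. [folklore] -/
theorem tailIdeal_antitone (xs : List R) : Antitone (tailIdeal xs) := fun _ _ hij =>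
  ofList_mono_of_subset fun _ hr => (List.drop_sublist_drop_left xs hij).subset hr

/-- `q_{i+1} = (xs[i]) + q_{i+2}`. [folklore] -/
theorem tailIdeal_eq_span_sup {i : ℕ} (hi : i < xs.length) :
    tailIdeal xs i = span {xs[i]} ⊔ tailIdeal xs (i + 1) := by
  rw [tailIdeal, List.drop_eq_getElem_cons hi, ofList_cons]

/-- `xs[l] ∈ q_{k+1}` for `k ≤ l`. [folklore] -/
theorem getElem_mem_tailIdeal {k l : ℕ} (hkl : k ≤ l) (hl : l < xs.length) :
    xs[l] ∈ tailIdeal xs k := by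
  refine Ideal.subset_span (List.mem_iff_getElem.mpr ⟨l - k, by rw [List.length_drop]; omega, ?_⟩)
  rw [List.getElem_drop]; congr 1; omega

/-- `tailIdeal xs i = ⊥` for `i ≥ d`. [folklore] -/
theorem tailIdeal_of_length_le {i : ℕ} (hi : xs.length ≤ i) : tailIdeal xs i = ⊥ := by
  rw [tailIdeal, List.drop_of_length_le hi, ofList_nil]

/-- `(seg xs k l) ⊆ q_{k+1}`. [folklore] -/
theorem ofList_seg_le_tailIdeal (xs : List R) (k l : ℕ) : ofList (seg xs k l) ≤ tailIdeal xs k :=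
  ofList_mono_of_subset fun _ hr => (seg_sublist_drop xs k l).subset hr

/-- Kawasaki's convention `x_{d+1} = 1`: `xs.getD l 1 = xs[l]` for `l < d`. [folklore] -/
theorem getD_eq_getElem {l : ℕ} (hl : l < xs.length) : xs.getD l 1 = xs[l] := by
  simp [hl]

/-- Kawasaki's convention `x_{d+1} = 1`: `xs.getD d 1 = 1`. [folklore] -/
theorem getD_length (xs : List R) : xs.getD xs.length 1 = 1 := by
  simp

/-- `prodPow` over the empty interval is `R`. [folklore] -/
theorem prodPow_of_lt {n : ℕ → ℕ} {i j : ℕ} (h : j < i) : prodPow xs n i j = ⊤ := by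
  rw [prodPow, Finset.Icc_eq_empty_of_lt h, Finset.prod_empty, one_eq_top]

/-- `prodPow xs n i i = q_{i+1}^{n(i)}`. [folklore] -/
theorem prodPow_self (xs : List R) (n : ℕ → ℕ) (i : ℕ) : prodPow xs n i i = tailIdeal xs i ^ n i := by
  rw [prodPow, Finset.Icc_self, Finset.prod_singleton]

/-- Splitting off the first factor: `∏_{t=i}^{j} = qᵢ₊₁^{n i} · ∏_{t=i+1}^{j}` for `i ≤ j`.
[folklore] -/
theorem prodPow_eq_mul (n : ℕ → ℕ) {i j : ℕ} (hij : i ≤ j) :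
    prodPow xs n i j = tailIdeal xs i ^ n i * prodPow xs n (i + 1) j := by
  classical
  rw [prodPow, prodPow, ← Finset.insert_Icc_succ_left_eq_Icc hij, Finset.prod_insert (by simp)]
  rfl

/-- `prodPow` only depends on the exponents on `[i, j]`. [folklore] -/
theorem prodPow_congr {n n' : ℕ → ℕ} {i j : ℕ} (h : ∀ t ∈ Finset.Icc i j, n t = n' t) :
    prodPow xs n i j = prodPow xs n' i j :=
  Finset.prod_congr rfl fun t ht => by rw [h t ht]

/-- **Decreasing one exponent**: for `k ∈ [i, j]` with `n k ≥ 1`,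
`qᵢ^{nᵢ}⋯qⱼ^{nⱼ} = q_k · (qᵢ^{nᵢ}⋯q_k^{n_k - 1}⋯qⱼ^{nⱼ})`. [folklore] -/
theorem prodPow_eq_mul_update {n : ℕ → ℕ} {i j k : ℕ} (hk : k ∈ Finset.Icc i j) (hnk : 0 < n k) :
    prodPow xs n i j = tailIdeal xs k * prodPow xs (Function.update n k (n k - 1)) i j := by
  classical
  rw [prodPow, prodPow, ← Finset.mul_prod_erase _ _ hk, ← Finset.mul_prod_erase _ _ hk,
    Function.update_self, ← mul_assoc, ← pow_succ', Nat.sub_add_cancel hnk]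
  congr 1
  exact Finset.prod_congr rfl fun t ht => by
    rw [Function.update_of_ne (Finset.ne_of_mem_erase ht)]

/-- `qᵢ^{nᵢ}⋯qⱼ^{nⱼ} ⊆ q_k` for `k ∈ [i, j]` with `n k ≥ 1`. [folklore] -/
theorem prodPow_le_tailIdeal {n : ℕ → ℕ} {i j k : ℕ} (hk : k ∈ Finset.Icc i j) (hnk : 0 < n k) :
    prodPow xs n i j ≤ tailIdeal xs k := by
  rw [prodPow_eq_mul_update hk hnk]
  exact Ideal.mul_le_right

/-- `prodPow` is antitone in the exponents. [folklore] -/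
theorem prodPow_anti {n n' : ℕ → ℕ} {i j : ℕ} (h : ∀ t ∈ Finset.Icc i j, n t ≤ n' t) :
    prodPow xs n' i j ≤ prodPow xs n i j := by
  classical
  unfold prodPow
  induction j with
  | zero =>
    rcases Nat.eq_zero_or_pos i with rfl | hi
    · rw [Finset.Icc_self, Finset.prod_singleton, Finset.prod_singleton]
      exact Ideal.pow_le_pow_right (h 0 (by simp))
    · rw [Finset.Icc_eq_empty_of_lt hi, Finset.prod_empty, Finset.prod_empty]
  | succ j ih =>
    rcases Nat.lt_or_ge (j + 1) i with hlt | hle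
    · rw [Finset.Icc_eq_empty_of_lt hlt, Finset.prod_empty, Finset.prod_empty]
    · rw [Finset.prod_Icc_succ_top hle, Finset.prod_Icc_succ_top hle]
      refine Ideal.mul_mono (ih fun t ht => h t ?_) (Ideal.pow_le_pow_right (h (j + 1) (by simp [hle])))
      rw [Finset.mem_Icc] at ht ⊢
      omega

/-- Splitting off the whole `k`-th factor: `∏ q_t^{f t} = q_k^{f k} · ∏ q_t^{f' t}` with
`f' = f` except `f' k = 0`. [folklore] -/
theorem prodPow_eq_pow_mul_update_zero {f : ℕ → ℕ} {i j k : ℕ} (hk : k ∈ Finset.Icc i j) :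
    prodPow xs f i j = tailIdeal xs k ^ f k * prodPow xs (Function.update f k 0) i j := by
  classical
  rw [prodPow, prodPow, ← Finset.mul_prod_erase _ _ hk, ← Finset.mul_prod_erase _ _ hk,
    Function.update_self, pow_zero, one_mul]
  congr 1
  exact Finset.prod_congr rfl fun t ht => by rw [Function.update_of_ne (Finset.ne_of_mem_erase ht)]

/-- `prodPow` with all exponents `0` is `R`. [folklore] -/
theorem prodPow_eq_top_of_forall_eq_zero {f : ℕ → ℕ} {i j : ℕ} (h : ∀ t ∈ Finset.Icc i j, f t = 0) :
    prodPow xs f i j = ⊤ := by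
  rw [prodPow, Finset.prod_eq_one fun t ht => by rw [h t ht, pow_zero], one_eq_top]

end Ring

/-! ## Goto–Yamagishi on `M/N`, read in `M` (non-colon form) -/

section Module

variable {R : Type u} [CommRing R] {M : Type v} [AddCommGroup M] [Module R M]

/-- **Goto–Yamagishi on a quotient, pulled back to `M`** (Kawasaki 2000, Lemma 2.2 for `M/N`,
the case "`i = s + 1`" included): if `zs` is a `d`-sequence on `M/N` in Kawasaki's sense and
`𝔮 = (z₁,…,z_s)` then `(N + (z₁,…,z_t)M) ∩ (N + 𝔮ⁿ⁺¹M) = N + (z₁,…,z_t)𝔮ⁿM` for every `t`.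
[cite: Kawasaki2000, Lemma 2.2] -/
theorem IsKDSequence.sup_inf_sup_pow_smul_top {N : Submodule R M} {zs : List R}
    (h : IsKDSequence N zs) (n t : ℕ) :
    (N ⊔ ofList (zs.take t) • ⊤) ⊓ (N ⊔ ofList zs ^ (n + 1) • ⊤) =
      N ⊔ ofList (zs.take t) • (ofList zs ^ n • (⊤ : Submodule R M)) := by
  have hq := (h.isDSequence_quotient).take_smul_top_inf_pow_smul_top n t
  have e2 : ∀ (I : Ideal R), (I • (ofList zs ^ n • (⊤ : Submodule R (M ⧸ N)))).comap N.mkQ =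
      N ⊔ I • (ofList zs ^ n • ⊤) := fun I => by
    rw [← Submodule.mul_smul, comap_mkQ_smul_top, Submodule.mul_smul]
  have := congrArg (Submodule.comap N.mkQ) hq
  rwa [Submodule.comap_inf, comap_mkQ_smul_top, comap_mkQ_smul_top, e2] at this

/-! ## Small calculus used by every step -/

/-- Membership in `(a)·P`: `m = a·p` with `p ∈ P`. [folklore] -/
theorem mem_span_singleton_smul_iff {a : R} {P : Submodule R M} {m : M} :
    m ∈ span {a} • P ↔ ∃ p ∈ P, m = a • p := by
  rw [Submodule.ideal_span_singleton_smul, Submodule.mem_smul_pointwise_iff_exists]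
  exact ⟨fun ⟨p, hp, e⟩ => ⟨p, hp, e.symm⟩, fun ⟨p, hp, e⟩ => ⟨p, hp, e.symm⟩⟩

/-- `I·{(N + P) : a} ⊆ (N + I·P) : a` — "the opposite inclusion is obvious" in Kawasaki's
Steps 2, 5, 7. [folklore] -/
theorem ideal_smul_colonBy_sup_le (I : Ideal R) (N P : Submodule R M) (a : R) :
    I • colonBy (N ⊔ P) a ≤ colonBy (N ⊔ I • P) a := by
  refine Submodule.smul_le.mpr fun r hr z hz => ?_
  rw [mem_colonBy] at hz ⊢
  rw [smul_comm]
  obtain ⟨w, hw, p, hp, e⟩ := Submodule.mem_sup.mp hz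
  rw [← e, smul_add]
  exact Submodule.add_mem_sup (N.smul_mem r hw) (Submodule.smul_mem_smul hr hp)

/-- Enlarging the left summand of `N + P`. [folklore] -/
theorem mem_sup_of_le_left {N N' P : Submodule R M} (h : N ≤ N') {m : M} (hm : m ∈ N ⊔ P) :
    m ∈ N' ⊔ P :=
  (sup_le_sup_right h P) hm

/-- Enlarging the right summand of `N + P`. [folklore] -/
theorem mem_sup_of_le_right {N P P' : Submodule R M} (h : P ≤ P') {m : M} (hm : m ∈ N ⊔ P) :
    m ∈ N ⊔ P' :=
  (sup_le_sup_left h N) hm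

/-- `y·m ∈ (ys)M` for `y ∈ ys`. [folklore] -/
theorem smul_mem_ofList_smul_top {ys : List R} {y : R} (hy : y ∈ ys) (m : M) :
    y • m ∈ (ofList ys • ⊤ : Submodule R M) :=
  Submodule.smul_mem_smul (Ideal.subset_span hy) Submodule.mem_top

/-- `(A ++ B)·P = (A)·P + (B)·P`. [folklore] -/
theorem ofList_append_smul (A B : List R) (P : Submodule R M) :
    ofList (A ++ B) • P = ofList A • P ⊔ ofList B • P := by
  rw [ofList_append, Submodule.sup_smul]

/-- **`J·(qᵢ^{nᵢ}⋯q_k^{n_k-1}⋯qⱼ^{nⱼ})P ⊆ (qᵢ^{nᵢ}⋯qⱼ^{nⱼ})P` for `J ⊆ q_k`** (how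
`(x_k,…,x_{l-1})`, `x_l ∈ q_k` re-absorb the decremented exponent). [folklore] -/
theorem smul_prodPow_update_smul_le {xs : List R} {n : ℕ → ℕ} {i j k : ℕ} {J : Ideal R}
    (hJ : J ≤ tailIdeal xs k) (hk : k ∈ Finset.Icc i j) (hnk : 0 < n k) (P : Submodule R M) :
    J • (prodPow xs (Function.update n k (n k - 1)) i j • P) ≤ prodPow xs n i j • P := by
  rw [← Submodule.mul_smul, prodPow_eq_mul_update hk hnk]
  exact Submodule.smul_mono_left (Ideal.mul_mono_left hJ)

end Module

/-! ## The five statements of Theorem 3.1 -/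

namespace Kawasaki

variable {R : Type u} [CommRing R] [IsLocalRing R]
variable (M : Type v) [AddCommGroup M] [Module R M]

/-- Positivity of the exponents `nᵢ,…,nⱼ` ("for any positive integers `nᵢ,…,nⱼ`").
[cite: Kawasaki2000, Thm. 3.1] -/
def PosOn (n : ℕ → ℕ) (i j : ℕ) : Prop :=
  ∀ t ∈ Finset.Icc i j, 0 < n t

/-- **Statement (A_ij) of Kawasaki 2000, Thm. 3.1, (3.1.1)** (`0`-based `i ≤ j`): for positive
`nᵢ,…,nⱼ`, every subsystem of parameters `y₁,…,y_u` of `M/q_{i+1}M` and all `i ≤ k ≤ j`,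
`k ≤ l ≤ d`:
`(y, x_{k+1},…,x_l)M : x_{l+1} ∩ [(y)M + q^{n}M] = (y)M + (x_{k+1},…,x_l)·q_{i+1}^{nᵢ}⋯q_{k+1}^{n_k-1}⋯q_{j+1}^{nⱼ}M`
where `q^n = q_{i+1}^{nᵢ}⋯q_{j+1}^{nⱼ}` and `x_{d+1} = 1`. [cite: Kawasaki2000, Thm. 3.1 (3.1.1)] -/
def A31 (xs : List R) (i j : ℕ) : Prop :=
  ∀ (n : ℕ → ℕ), PosOn n i j → ∀ (ys : List R), IsSecantSequence M (xs.drop i ++ ys) →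
    (∀ y ∈ ys, y ∈ maximalIdeal R) → ∀ (k l : ℕ), i ≤ k → k ≤ j → k ≤ l → l ≤ xs.length →
      colonBy (ofList (ys ++ seg xs k l) • ⊤ : Submodule R M) (xs.getD l 1) ⊓
          (ofList ys • ⊤ ⊔ prodPow xs n i j • ⊤) =
        ofList ys • ⊤ ⊔ ofList (seg xs k l) • (prodPow xs (Function.update n k (n k - 1)) i j • ⊤)

/-- **Statement (B_ij) of Kawasaki 2000, Thm. 3.1, (3.1.2)** (`0`-based `i ≤ j`): for positive
`nᵢ,…,nⱼ`, every subsystem of parameters `y₁,…,y_u` (`u ≥ 1`, `Y = (y₁,…,y_{u-1})`) of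
`M/q_{i+1}M` and all `i ≤ k ≤ j`, `k ≤ l < d`:
`[(Y)M + (x_{k+1},…,x_{l+1})q^{n}M] : y_u = (x_{k+1},…,x_{l+1})·{[(Y)M + q^{n}M] : y_u} + (Y)M : y_u`.
[cite: Kawasaki2000, Thm. 3.1 (3.1.2)] -/
def B31 (xs : List R) (i j : ℕ) : Prop :=
  ∀ (n : ℕ → ℕ), PosOn n i j → ∀ (Y : List R) (yu : R),
    IsSecantSequence M (xs.drop i ++ (Y ++ [yu])) → (∀ y ∈ Y ++ [yu], y ∈ maximalIdeal R) →
    ∀ (k l : ℕ), i ≤ k → k ≤ j → k ≤ l → l < xs.length →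
      colonBy (ofList Y • ⊤ ⊔ ofList (seg xs k (l + 1)) • (prodPow xs n i j • ⊤) : Submodule R M) yu =
        ofList (seg xs k (l + 1)) • colonBy (ofList Y • ⊤ ⊔ prodPow xs n i j • ⊤ : Submodule R M) yu ⊔
          colonBy (ofList Y • ⊤ : Submodule R M) yu

/-- **Statement (C_ij) of Kawasaki 2000, Thm. 3.1, (3.1.3)** (`0`-based `i ≤ j`): for positive
`nᵢ,…,nⱼ` and every subsystem of parameters `y₁,…,y_u` (`u ≥ 1`) of `M/q_{i+1}M`:
`[(Y)M + q^{n}M] : y_u ⊆ (Y)M : y_u + q_{i+1}^{nᵢ-1}q_{i+2}^{n_{i+1}}⋯q_{j+1}^{nⱼ}M`.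
[cite: Kawasaki2000, Thm. 3.1 (3.1.3)] -/
def C31 (xs : List R) (i j : ℕ) : Prop :=
  ∀ (n : ℕ → ℕ), PosOn n i j → ∀ (Y : List R) (yu : R),
    IsSecantSequence M (xs.drop i ++ (Y ++ [yu])) → (∀ y ∈ Y ++ [yu], y ∈ maximalIdeal R) →
      colonBy (ofList Y • ⊤ ⊔ prodPow xs n i j • ⊤ : Submodule R M) yu ≤
        colonBy (ofList Y • ⊤ : Submodule R M) yu ⊔ prodPow xs (Function.update n i (n i - 1)) i j • ⊤

/-- **Statement (D_ij) of Kawasaki 2000, Thm. 3.1, (3.1.4)** (`0`-based `i ≤ j < d`): for every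
subsystem of parameters `y₁,…,y_u` (`u ≥ 1`) of `M/q_{i+1}M`:
`[(Y)M + q_{i+1}⋯q_{j+1}M] : y_u ∩ x_{i+1}M ⊆ x_{i+1}·{[(Y)M + q_{i+2}⋯q_{j+1}M] : y_u} + (Y)M`
(all exponents `1`; "here we put `q_{i+1}⋯q_jM = M` if `i = j`", `1`-based — the empty product).
[cite: Kawasaki2000, Thm. 3.1 (3.1.4)] -/
def D31 (xs : List R) (i j : ℕ) : Prop :=
  ∀ (hi : i < xs.length) (Y : List R) (yu : R),
    IsSecantSequence M (xs.drop i ++ (Y ++ [yu])) → (∀ y ∈ Y ++ [yu], y ∈ maximalIdeal R) →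
      colonBy (ofList Y • ⊤ ⊔ prodPow xs (fun _ => 1) i j • ⊤ : Submodule R M) yu ⊓
          span {xs[i]} • ⊤ ≤
        span {xs[i]} • colonBy (ofList Y • ⊤ ⊔ prodPow xs (fun _ => 1) (i + 1) j • ⊤ :
          Submodule R M) yu ⊔ ofList Y • ⊤

/-- **Statement (E_ij) of Kawasaki 2000, Thm. 3.1, (3.1.5)** (`0`-based `i ≤ j`): for positive
`nᵢ,…,nⱼ`, every `k ≤ i`, every subsystem of parameters `y₁,…,y_u = Y, y_u` of `M/q_{k+1}M`
whose last element kills the parameter colons of `M/q_{k+1}M` (in print: `y_u ∈ 𝔞(M/q_kM)`),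
every `v ≤ u` (`m = v - 1`) and every `Λ ⊆ {k+1,…,i}` (a sublist `L` of `seg xs k i`):
`[(y_{<v}, x_Λ)M + q^{n}M] : y_vy_u = [(y_{<v}, x_Λ)M + q^{n}M] : y_u`.
(Kawasaki asks `2 ≤ k`, `1`-based, only to avoid a vacuous case.) [cite: Kawasaki2000, Thm. 3.1 (3.1.5)] -/
def E31 (xs : List R) (i j : ℕ) : Prop :=
  ∀ (n : ℕ → ℕ), PosOn n i j → ∀ (k : ℕ), k ≤ i → ∀ (ys Y : List R) (yu : R), ys = Y ++ [yu] →
    IsSecantSequence M (xs.drop k ++ ys) → (∀ y ∈ ys, y ∈ maximalIdeal R) →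
    KillsParameterColons (M ⧸ (tailIdeal xs k • ⊤ : Submodule R M)) yu →
    ∀ (m : ℕ) (hm : m < ys.length) (L : List R), L.Sublist (seg xs k i) →
      colonBy (ofList (ys.take m ++ L) • ⊤ ⊔ prodPow xs n i j • ⊤ : Submodule R M) (ys[m] * yu) =
        colonBy (ofList (ys.take m ++ L) • ⊤ ⊔ prodPow xs n i j • ⊤ : Submodule R M) yu

/-- All five statements at `(i, j)`. [cite: Kawasaki2000, Thm. 3.1] -/
def All31 (xs : List R) (i j : ℕ) : Prop :=
  A31 M xs i j ∧ B31 M xs i j ∧ C31 M xs i j ∧ D31 M xs i j ∧ E31 M xs i j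

variable {M}

/-- Positivity restricts to sub-intervals. [folklore] -/
theorem PosOn.mono {n : ℕ → ℕ} {i j i' j' : ℕ} (h : PosOn n i j) (hi : i ≤ i') (hj : j' ≤ j) :
    PosOn n i' j' := fun t ht => h t (by rw [Finset.mem_Icc] at ht ⊢; omega)

/-- Positivity survives decreasing an exponent that is at least `2`. [folklore] -/
theorem PosOn.update {n : ℕ → ℕ} {i j k : ℕ} (h : PosOn n i j) (hk : 1 < n k) :
    PosOn (Function.update n k (n k - 1)) i j := by
  intro t ht
  rcases eq_or_ne t k with rfl | htk
  · rw [Function.update_self]; omega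
  · rw [Function.update_of_ne htk]; exact h t ht

/-- Positivity for the constant exponent `1`. [folklore] -/
theorem posOn_one (i j : ℕ) : PosOn (fun _ => 1) i j := fun _ _ => Nat.one_pos

end Kawasaki

end Literature.AlgebraicGeometry.Resolution
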